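import Literature.Analysis.FluidPDE.ElgindiTransportEstimate
import HarnessLib

/-!
# The second transport estimate (Elgindi–Ghoul–Masmoudi, Proposition 9.5): velocities with bounded
words ([ElgindiGhoulMasmoudi2021] §9 Proposition 9.5; [Elgindi2021] §8.2 Lemma 8.9)

Topic `Literature/Analysis/FluidPDE`. Proof file (everything proved, no definitions, no named
facts) on the proof path of the named fact
`Literature.Analysis.FluidPDE.Elgindi.ElgindiGhoulMasmoudi2021_stabilityCore`
(`ElgindiStabilityDecomposition.lean`). Elgindi–Ghoul–Masmoudi, arXiv:1910.14071, §9
Proposition 9.5 (p. 20, "Second Transport Estimate"): "Assume `k ≥ 4` and that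
`D_θu, D_zv ∈ 𝓦^{k,∞}` and `g ∈ 𝓗ᵏ`. Then `|(uD_θg, g)_{𝓗ᵏ}| ≤ (C/√(γ−1))|u|_{𝓦^{k,∞}}|g|²_{𝓗ᵏ}` and
`|(vD_zg, g)_{𝓗ᵏ}| ≤ (C/√(γ−1))|v|_{𝓦^{k,∞}}|g|²_{𝓗ᵏ}`"; T. M. Elgindi, arXiv:1904.04795, §8.2
Lemma 8.9 (p. 26): "If `f ∈ 𝓦^{4,∞}` and `g ∈ 𝓗⁴`, then
`|(fD_zg, g)_{𝓗⁴}| + |(fD_θg, g)_{𝓗⁴}| ≤ (C/√(γ−1))|f|_{𝓦^{4,∞}}|g|²_{𝓗⁴}`. The proof … is much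
simpler than the proof of Lemma 8.7 since when any derivative hits `f` we can simply estimate that
term pointwise using `|f|_{𝓦^{4,∞}}` while the other term can be estimated using integration by
parts." This is the form of the transport estimates used for the *linearised* operator `𝓜_F`
([ElgindiGhoulMasmoudi2021] §3.2, the terms `U(Φ_F)∂_θε`, `αV(Φ_F)y∂_yε`), whose velocities are
explicit functions of the profile, smooth in the open strip with bounded words but *not* in `𝓗⁴`.

**What is proved** (at `k = 4`, for test functions `g` of the open strip and the `𝓗⁴`-type inner
products `hkForm α 3 λ Λ` of `ElgindiHkCoercivity.lean`; the velocity is any function smooth in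
the open strip, the information used being a.e. bounds on its words `D_θ^iD_z^j`, `i + j ≤ 4` — the
multiplier form of `ElgindiWkProductRule.lean`, which a `𝓦^{4,∞}` bound supplies by
`ae_abs_word_le_of_eWkNorm_le`):
* `abs_wordPairing_Dθ_sup_le`, `abs_hkForm_transport_Dθ_sup_le`: if `|D_θ^iD_z^ju| ≤ B` a.e. on the
  strip (`i + j ≤ 4`) then `|(uD_θg, g)| ≤ C(λ,Λ)·12800·B·|g|²_{𝓗⁴}` — **no loss `1/√(γ−1)`** (the
  printed loss comes from `L^∞` bounds of `𝓗⁴` functions, not needed for bounded velocities);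
* `abs_wordPairing_Dz_sup_le`, `abs_hkForm_transport_Dz_sup_le`: the same for `(vD_zg, g)` under
  `|D_z^jv| ≤ B` and `|D_θ^iD_z^jv| ≤ B·sin(2θ)` for `i ≥ 1`.

**On the hypothesis for the `D_z` part.** In the word `D_θD_z³(vD_zg)` the Leibniz term
`(D_θv)(D_z⁴g)` is paired with `D_θD_z³g` against the *strong* weight `w²sin(2θ)^{−γ}`, while the
radial word `D_z⁴g` only carries the weak weight `sin(2θ)^{−η}` in `|g|_{𝓗⁴}`; a bound on
`sup|D_θv|` alone does not control this term uniformly (one needs `(D_θv)²sin(2θ)^{−γ} ≲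
sin(2θ)^{−η}`), so we ask the angular words of the velocity to vanish to first order at the
boundary, `|D_θ^iD_z^jv| ≤ B sin 2θ` (`i ≥ 1`), which is what the explicit velocities of `𝓜_F`
(trigonometric polynomials in `θ` times rational functions of `z`, and `αV(Φ)` with `∂_θθΦ`
bounded) satisfy. For the `D_θ` part no such condition is needed: there the `g`-factor of every
Leibniz term keeps an angular derivative.

Proof: Leibniz on the strip (`iterate_Dθ_Dz_mul_strip`); the terms where a derivative falls on the
velocity are bounded pointwise and by `2|YZ| ≤ Y² + Z²`; the term where all derivatives fall on `g`
is integrated by parts (`integral_transport_Dθ/Dz`, here extended to strip-smooth velocities by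
localisation, `exists_test_eqOn`).
-/

noncomputable section

open MeasureTheory Set Function Real Filter Finset
open _root_.Topology
open scoped ENNReal ContDiff

namespace Literature.Analysis.FluidPDE

namespace Elgindi

/-! ### Integration by parts against strip-smooth velocities -/

/-- A test function of the strip agreeing with a given strip-smooth function near the support of a
test function `Z`. [folklore] -/
theorem exists_stripTest_eqOn_tsupport {u Z : ℝ → ℝ → ℝ} (hu : ContDiffOn ℝ ∞ (uncurry u) strip) (hZ : StripTest Z) :
    ∃ (W : Set (ℝ × ℝ)) (ut : ℝ → ℝ → ℝ), IsOpen W ∧ tsupport (uncurry Z) ⊆ W ∧ W ⊆ strip ∧ StripTest ut ∧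
      ∀ q ∈ W, ut q.1 q.2 = u q.1 q.2 := by
  obtain ⟨W, Ψt, hW, hKW, hWS, hΨt, hΨc, hΨs, hEq⟩ := exists_test_eqOn hu hZ.supp hZ.sub
  refine ⟨W, fun z θ => Ψt (z, θ), hW, hKW, hWS, ⟨fun n => ?_, hΨc, hΨs⟩, fun q hq => hEq hq⟩
  have := contDiff_infty.1 hΨt n
  exact this

/-- Off the support of `Z`, `Z` vanishes (curried form). [folklore] -/
private theorem eq_zero_of_notMem_tsupport_curry {Z : ℝ → ℝ → ℝ} {p : ℝ × ℝ} (hp : p ∉ tsupport (uncurry Z)) : Z p.1 p.2 = 0 := by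
  have := image_eq_zero_of_notMem_tsupport hp
  simpa [uncurry] using this

/-- **The `D_θ`-transport identity for a strip-smooth velocity**: for `u ∈ C^∞(strip)` and a test
function `Z`, `∫∫ u·D_θZ·Z·w²s^{−c} = −½∫∫ Z²w²s^{−c}(D_θu + 2(1−c)cos(2θ)u)`. [cite: Elgindi2021, §8.2 Lemma 8.9 and §8.1 proof of Lemma 8.7 (p. 26 of arXiv:1904.04795)] -/
theorem integral_transport_Dθ_smooth {u Z : ℝ → ℝ → ℝ} (hu : ContDiffOn ℝ ∞ (uncurry u) strip) (hZ : StripTest Z) (c : ℝ) :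
    ∫ p in strip, u p.1 p.2 * Dθ Z p.1 p.2 * Z p.1 p.2 * radialWeight p.1 ^ 2 * Real.sin (2 * p.2) ^ (-c) =
      -(1 / 2) * ∫ p in strip, Z p.1 p.2 ^ 2 * radialWeight p.1 ^ 2 * Real.sin (2 * p.2) ^ (-c) *
        (Dθ u p.1 p.2 + 2 * (1 - c) * Real.cos (2 * p.2) * u p.1 p.2) := by
  obtain ⟨W, ut, hW, hKW, -, hut, hEq⟩ := exists_stripTest_eqOn_tsupport hu hZ
  have hD : ∀ q ∈ W, Dθ ut q.1 q.2 = Dθ u q.1 q.2 := fun q hq => iterate_Dθ_congr_open hW hEq 1 q hq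
  have e1 : ∫ p in strip, u p.1 p.2 * Dθ Z p.1 p.2 * Z p.1 p.2 * radialWeight p.1 ^ 2 * Real.sin (2 * p.2) ^ (-c) =
      ∫ p in strip, ut p.1 p.2 * Dθ Z p.1 p.2 * Z p.1 p.2 * radialWeight p.1 ^ 2 * Real.sin (2 * p.2) ^ (-c) := by
    refine setIntegral_congr_fun measurableSet_strip fun p _ => ?_
    by_cases hpW : p ∈ W
    · rw [hEq p hpW]
    · rw [eq_zero_of_notMem_tsupport_curry (fun h => hpW (hKW h))]; simp
  have e2 : ∫ p in strip, Z p.1 p.2 ^ 2 * radialWeight p.1 ^ 2 * Real.sin (2 * p.2) ^ (-c) * (Dθ u p.1 p.2 + 2 * (1 - c) * Real.cos (2 * p.2) * u p.1 p.2) =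
      ∫ p in strip, Z p.1 p.2 ^ 2 * radialWeight p.1 ^ 2 * Real.sin (2 * p.2) ^ (-c) * (Dθ ut p.1 p.2 + 2 * (1 - c) * Real.cos (2 * p.2) * ut p.1 p.2) := by
    refine setIntegral_congr_fun measurableSet_strip fun p _ => ?_
    by_cases hpW : p ∈ W
    · rw [hEq p hpW, hD p hpW]
    · rw [eq_zero_of_notMem_tsupport_curry (fun h => hpW (hKW h))]; simp
  rw [e1, e2]
  exact integral_transport_Dθ hut hZ c

/-- **The `D_z`-transport identity for a strip-smooth velocity**: for `v ∈ C^∞(strip)` and a test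
function `Z`, `∫∫ v·D_zZ·Z·w²s^{−c} = −½∫∫ Z²w²s^{−c}(D_zv + ((z−3)/(1+z))v)`. [cite: Elgindi2021, §8.2 Lemma 8.9 and §8.1 Lemma 8.8 (p. 26 of arXiv:1904.04795)] -/
theorem integral_transport_Dz_smooth {v Z : ℝ → ℝ → ℝ} (hv : ContDiffOn ℝ ∞ (uncurry v) strip) (hZ : StripTest Z) (c : ℝ) :
    ∫ p in strip, v p.1 p.2 * Dz Z p.1 p.2 * Z p.1 p.2 * radialWeight p.1 ^ 2 * Real.sin (2 * p.2) ^ (-c) =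
      -(1 / 2) * ∫ p in strip, Z p.1 p.2 ^ 2 * radialWeight p.1 ^ 2 * Real.sin (2 * p.2) ^ (-c) *
        (Dz v p.1 p.2 + (p.1 - 3) / (1 + p.1) * v p.1 p.2) := by
  obtain ⟨W, vt, hW, hKW, -, hvt, hEq⟩ := exists_stripTest_eqOn_tsupport hv hZ
  have hD : ∀ q ∈ W, Dz vt q.1 q.2 = Dz v q.1 q.2 := fun q hq => iterate_Dz_congr_open hW hEq 1 q hq
  have e1 : ∫ p in strip, v p.1 p.2 * Dz Z p.1 p.2 * Z p.1 p.2 * radialWeight p.1 ^ 2 * Real.sin (2 * p.2) ^ (-c) =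
      ∫ p in strip, vt p.1 p.2 * Dz Z p.1 p.2 * Z p.1 p.2 * radialWeight p.1 ^ 2 * Real.sin (2 * p.2) ^ (-c) := by
    refine setIntegral_congr_fun measurableSet_strip fun p _ => ?_
    by_cases hpW : p ∈ W
    · rw [hEq p hpW]
    · rw [eq_zero_of_notMem_tsupport_curry (fun h => hpW (hKW h))]; simp
  have e2 : ∫ p in strip, Z p.1 p.2 ^ 2 * radialWeight p.1 ^ 2 * Real.sin (2 * p.2) ^ (-c) * (Dz v p.1 p.2 + (p.1 - 3) / (1 + p.1) * v p.1 p.2) =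
      ∫ p in strip, Z p.1 p.2 ^ 2 * radialWeight p.1 ^ 2 * Real.sin (2 * p.2) ^ (-c) * (Dz vt p.1 p.2 + (p.1 - 3) / (1 + p.1) * vt p.1 p.2) := by
    refine setIntegral_congr_fun measurableSet_strip fun p _ => ?_
    by_cases hpW : p ∈ W
    · rw [hEq p hpW, hD p hpW]
    · rw [eq_zero_of_notMem_tsupport_curry (fun h => hpW (hKW h))]; simp
  rw [e1, e2]
  exact integral_transport_Dz hvt hZ c

/-! ### Real-analysis helpers -/

/-- `|∫ f| ≤ (B/2)(∫ g + ∫ h)` from the pointwise bound `|f| ≤ (B/2)(g + h)` on the strip. [folklore] -/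
theorem abs_setIntegral_le_half_mul_add {f g h : ℝ × ℝ → ℝ} {B : ℝ}
    (hg : Integrable g (volume.restrict strip)) (hh : Integrable h (volume.restrict strip))
    (hbd : ∀ p ∈ strip, |f p| ≤ B / 2 * (g p + h p)) :
    |∫ p in strip, f p| ≤ B / 2 * ((∫ p in strip, g p) + ∫ p in strip, h p) := by
  have hle := norm_integral_le_of_norm_le ((hg.add hh).const_mul (B / 2))
    ((ae_restrict_iff' measurableSet_strip).2 (ae_of_all _ fun p hp => by
      rw [Real.norm_eq_abs]; exact hbd p hp))
  rw [Real.norm_eq_abs, MeasureTheory.integral_const_mul, integral_add' hg hh] at hle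
  exact hle

/-- Integrability of `X·Y·Z·w²s^{−c}` on the strip for `X ∈ C^∞(strip)` and test functions `Y, Z`. [folklore] -/
theorem integrable_XYZW_smooth {X Y Z : ℝ → ℝ → ℝ} (hX : ContDiffOn ℝ ∞ (uncurry X) strip) (hY : StripTest Y) (hZ : StripTest Z) (c : ℝ) :
    Integrable (fun p : ℝ × ℝ => X p.1 p.2 * Y p.1 p.2 * Z p.1 p.2 * radialWeight p.1 ^ 2 * Real.sin (2 * p.2) ^ (-c)) (volume.restrict strip) := by
  have hψ : ContDiffOn ℝ ∞ (fun p : ℝ × ℝ => uncurry X p * (radialWeight p.1 ^ 2 * Real.sin (2 * p.2) ^ (-c))) strip :=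
    hX.mul (contDiffOn_weight_rpow (-c))
  have h := ((hY.mul hZ).mulOn hψ).integrable
  exact (h.congr (ae_of_all _ fun p => by simp only [Pi.mul_apply, uncurry_apply_pair]; ring)).integrableOn

/-- Integrability of `Y²·w²s^{−c}` for a test function `Y`. [folklore] -/
theorem integrable_sqW {Y : ℝ → ℝ → ℝ} (hY : StripTest Y) (c : ℝ) :
    Integrable (fun p : ℝ × ℝ => Y p.1 p.2 ^ 2 * radialWeight p.1 ^ 2 * Real.sin (2 * p.2) ^ (-c)) (volume.restrict strip) := by
  have h := (hY.mul hY).mulOn (contDiffOn_weight_rpow (-c)) |>.integrable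
  exact (h.congr (ae_of_all _ fun p => by simp only [Pi.mul_apply]; ring)).integrableOn

/-- Words of a strip-smooth function are strip-smooth. [folklore] -/
theorem contDiffOn_word_strip_infty {u : ℝ → ℝ → ℝ} (hu : ContDiffOn ℝ ∞ (uncurry u) strip) (i j : ℕ) :
    ContDiffOn ℝ ∞ (uncurry (Dθ^[i] (Dz^[j] u))) strip :=
  contDiffOn_infty.2 fun m => contDiffOn_iterate_Dθ_Dz (N := i + j + m) (contDiffOn_infty.1 hu (i + j + m)) le_rfl

/-- `s^{2−c} ≤ s^{−η}` on the strip for `c ≤ 2 + η` (here `c ∈ {0, η, γ}`). [folklore] -/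
theorem sin_sq_mul_rpow_le_rpow_neg_eta {α : ℝ} (hα10 : α ≤ 10) {c : ℝ} (hc : c = 0 ∨ c = eta ∨ c = gammaExp α)
    {p : ℝ × ℝ} (hp : p ∈ strip) :
    Real.sin (2 * p.2) ^ 2 * Real.sin (2 * p.2) ^ (-c) ≤ Real.sin (2 * p.2) ^ (-eta) := by
  have hs : 0 < Real.sin (2 * p.2) := Real.sin_pos_of_pos_of_lt_pi (by linarith [hp.2.1]) (by linarith [hp.2.2])
  have hs1 : Real.sin (2 * p.2) ≤ 1 := Real.sin_le_one _
  have hc2 : -eta ≤ 2 + -c := by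
    rcases hc with h | h | h <;> rw [h] <;> unfold eta <;> [norm_num; norm_num; (unfold gammaExp; linarith)]
  calc Real.sin (2 * p.2) ^ 2 * Real.sin (2 * p.2) ^ (-c) = Real.sin (2 * p.2) ^ ((2:ℝ) + -c) := by
        rw [Real.rpow_add hs, Real.rpow_two]
    _ ≤ Real.sin (2 * p.2) ^ (-eta) := Real.rpow_le_rpow_of_exponent_ge hs hs1 hc2

section pieces

variable {α : ℝ} (hα : 0 < α) (hα10 : α ≤ 10) {u g : ℝ → ℝ → ℝ} (hu : ContDiffOn ℝ ∞ (uncurry u) strip) (hg : StripTest g)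
  {B : ℝ} (hB0 : 0 ≤ B)
include hα hα10 hu hg hB0

/-! ### The `D_θ`-transport word pairing with a bounded velocity -/

/-- **The integration-by-parts term, bounded velocity**: `|∫∫ u·D_θ(D^ag)·D^ag·w²s^{−c}| ≤
(½ + |1−c|)·B·E(g)` when `|u|, |D_θu| ≤ B` on the strip. [cite: Elgindi2021, §8.2 Lemma 8.9 (p. 26 of arXiv:1904.04795)] -/
theorem abs_integral_ibp_Dθ_sup_le (h0 : ∀ p ∈ strip, |u p.1 p.2| ≤ B) (h1 : ∀ p ∈ strip, |Dθ u p.1 p.2| ≤ B)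
    {a₁ a₂ : ℕ} (ha : a₁ + a₂ ≤ 4) {c : ℝ} (hc : c = 0 ∨ c = eta ∨ c = gammaExp α) (hgood : c = gammaExp α → 1 ≤ a₁) :
    |∫ p in strip, u p.1 p.2 * Dθ (Dθ^[a₁] (Dz^[a₂] g)) p.1 p.2 * (Dθ^[a₁] (Dz^[a₂] g)) p.1 p.2 * radialWeight p.1 ^ 2 * Real.sin (2 * p.2) ^ (-c)| ≤
      (1 / 2 + |1 - c|) * B * (eHkNormSq α 4 g).toReal := by
  set Z := Dθ^[a₁] (Dz^[a₂] g) with hZdef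
  have hZ : StripTest Z := hg.ofWord a₁ a₂
  rw [integral_transport_Dθ_smooth hu hZ c, abs_mul, show |(-(1 / 2) : ℝ)| = 1 / 2 by norm_num]
  have hI := integral_wordZ_le hα hα10 hg ha hc hgood
  have hi := integrable_sqW hZ c
  have hbound : ∀ p ∈ strip, |Z p.1 p.2 ^ 2 * radialWeight p.1 ^ 2 * Real.sin (2 * p.2) ^ (-c) * (Dθ u p.1 p.2 + 2 * (1 - c) * Real.cos (2 * p.2) * u p.1 p.2)| ≤
      (B * (1 + 2 * |1 - c|)) * (Z p.1 p.2 ^ 2 * radialWeight p.1 ^ 2 * Real.sin (2 * p.2) ^ (-c)) := by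
    intro p hp
    have hs : 0 < Real.sin (2 * p.2) := Real.sin_pos_of_pos_of_lt_pi (by linarith [hp.2.1]) (by linarith [hp.2.2])
    have hW : 0 ≤ Z p.1 p.2 ^ 2 * radialWeight p.1 ^ 2 * Real.sin (2 * p.2) ^ (-c) := by
      have := Real.rpow_nonneg hs.le (-c); positivity
    rw [abs_mul, abs_of_nonneg hW, mul_comm]
    refine mul_le_mul_of_nonneg_right ?_ hW
    calc |Dθ u p.1 p.2 + 2 * (1 - c) * Real.cos (2 * p.2) * u p.1 p.2| ≤ |Dθ u p.1 p.2| + |2 * (1 - c) * Real.cos (2 * p.2) * u p.1 p.2| := abs_add_le _ _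
      _ ≤ B + 2 * |1 - c| * 1 * B := by
          refine add_le_add (h1 p hp) ?_
          rw [abs_mul, abs_mul, abs_mul, show |(2:ℝ)| = 2 by norm_num]
          exact mul_le_mul (mul_le_mul_of_nonneg_left (Real.abs_cos_le_one _) (by positivity)) (h0 p hp) (abs_nonneg _) (by positivity)
      _ = B * (1 + 2 * |1 - c|) := by ring
  have hle := norm_integral_le_of_norm_le (hi.const_mul (B * (1 + 2 * |1 - c|)))
    ((ae_restrict_iff' measurableSet_strip).2 (ae_of_all _ fun p hp => by
      rw [Real.norm_eq_abs]; exact hbound p hp))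
  rw [Real.norm_eq_abs, MeasureTheory.integral_const_mul] at hle
  calc 1 / 2 * |∫ p in strip, Z p.1 p.2 ^ 2 * radialWeight p.1 ^ 2 * Real.sin (2 * p.2) ^ (-c) * (Dθ u p.1 p.2 + 2 * (1 - c) * Real.cos (2 * p.2) * u p.1 p.2)|
      ≤ 1 / 2 * ((B * (1 + 2 * |1 - c|)) * ∫ p in strip, Z p.1 p.2 ^ 2 * radialWeight p.1 ^ 2 * Real.sin (2 * p.2) ^ (-c)) :=
        mul_le_mul_of_nonneg_left hle (by norm_num)
    _ ≤ 1 / 2 * ((B * (1 + 2 * |1 - c|)) * (eHkNormSq α 4 g).toReal) :=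
        mul_le_mul_of_nonneg_left (mul_le_mul_of_nonneg_left hI (by positivity)) (by norm_num)
    _ = (1 / 2 + |1 - c|) * B * (eHkNormSq α 4 g).toReal := by ring

omit hu in
/-- **The cross terms, bounded velocity**: `|∫∫ X·Y·Z·w²s^{−c}| ≤ B·E(g)` for `X = D^{(l,k)}u` with
`|X| ≤ B` on the strip, `Y = D_θ^{a₁−l+1}D_z^{a₂−k}g`, `Z = D^ag`, `(l,k) ≠ (0,0)` (pointwise bound and
`2|YZ| ≤ Y² + Z²`). [cite: Elgindi2021, §8.2 Lemma 8.9 (p. 26 of arXiv:1904.04795)] -/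
theorem abs_integral_cross_Dθ_sup_le {a₁ a₂ l k : ℕ} (ha : a₁ + a₂ ≤ 4) (hl : l ≤ a₁) (hk : k ≤ a₂) (hlk : ¬(l = 0 ∧ k = 0))
    (hX : ∀ p ∈ strip, |(Dθ^[l] (Dz^[k] u)) p.1 p.2| ≤ B)
    {c : ℝ} (hc : c = 0 ∨ c = eta ∨ c = gammaExp α) (hgood : c = gammaExp α → 1 ≤ a₁) :
    |∫ p in strip, (Dθ^[l] (Dz^[k] u)) p.1 p.2 * (Dθ^[a₁ - l + 1] (Dz^[a₂ - k] g)) p.1 p.2 * (Dθ^[a₁] (Dz^[a₂] g)) p.1 p.2 *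
        radialWeight p.1 ^ 2 * Real.sin (2 * p.2) ^ (-c)| ≤ B * (eHkNormSq α 4 g).toReal := by
  set X := Dθ^[l] (Dz^[k] u) with hXd
  set Y := Dθ^[a₁ - l + 1] (Dz^[a₂ - k] g) with hY
  set Z := Dθ^[a₁] (Dz^[a₂] g) with hZ'
  have hYt : StripTest Y := hg.ofWord _ _
  have hZt : StripTest Z := hg.ofWord a₁ a₂
  have hIY : ∫ p in strip, Y p.1 p.2 ^ 2 * radialWeight p.1 ^ 2 * Real.sin (2 * p.2) ^ (-c) ≤ (eHkNormSq α 4 g).toReal :=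
    integral_wordZ_le hα hα10 hg (a₁ := a₁ - l + 1) (a₂ := a₂ - k) (by omega) hc (fun _ => by omega)
  have hIZ : ∫ p in strip, Z p.1 p.2 ^ 2 * radialWeight p.1 ^ 2 * Real.sin (2 * p.2) ^ (-c) ≤ (eHkNormSq α 4 g).toReal :=
    integral_wordZ_le hα hα10 hg ha hc hgood
  have hbd : ∀ p ∈ strip, |X p.1 p.2 * Y p.1 p.2 * Z p.1 p.2 * radialWeight p.1 ^ 2 * Real.sin (2 * p.2) ^ (-c)| ≤
      B / 2 * ((Y p.1 p.2 ^ 2 * radialWeight p.1 ^ 2 * Real.sin (2 * p.2) ^ (-c)) + (Z p.1 p.2 ^ 2 * radialWeight p.1 ^ 2 * Real.sin (2 * p.2) ^ (-c))) := by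
    intro p hp
    have hs : 0 < Real.sin (2 * p.2) := Real.sin_pos_of_pos_of_lt_pi (by linarith [hp.2.1]) (by linarith [hp.2.2])
    have hWnn : 0 ≤ radialWeight p.1 ^ 2 * Real.sin (2 * p.2) ^ (-c) := mul_nonneg (sq_nonneg _) (Real.rpow_nonneg hs.le (-c))
    have hx := hX p hp
    have h2 : |Y p.1 p.2| * |Z p.1 p.2| ≤ (Y p.1 p.2 ^ 2 + Z p.1 p.2 ^ 2) / 2 := by
      nlinarith [sq_nonneg (|Y p.1 p.2| - |Z p.1 p.2|), sq_abs (Y p.1 p.2), sq_abs (Z p.1 p.2)]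
    calc |X p.1 p.2 * Y p.1 p.2 * Z p.1 p.2 * radialWeight p.1 ^ 2 * Real.sin (2 * p.2) ^ (-c)|
        = |X p.1 p.2| * (|Y p.1 p.2| * |Z p.1 p.2|) * (radialWeight p.1 ^ 2 * Real.sin (2 * p.2) ^ (-c)) := by
          rw [show X p.1 p.2 * Y p.1 p.2 * Z p.1 p.2 * radialWeight p.1 ^ 2 * Real.sin (2 * p.2) ^ (-c) =
            (X p.1 p.2 * (Y p.1 p.2 * Z p.1 p.2)) * (radialWeight p.1 ^ 2 * Real.sin (2 * p.2) ^ (-c)) by ring,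
            abs_mul, abs_mul, abs_mul, abs_of_nonneg hWnn]
      _ ≤ B * ((Y p.1 p.2 ^ 2 + Z p.1 p.2 ^ 2) / 2) * (radialWeight p.1 ^ 2 * Real.sin (2 * p.2) ^ (-c)) := by
          refine mul_le_mul_of_nonneg_right ?_ hWnn
          exact mul_le_mul hx h2 (mul_nonneg (abs_nonneg _) (abs_nonneg _)) hB0
      _ = B / 2 * ((Y p.1 p.2 ^ 2 * radialWeight p.1 ^ 2 * Real.sin (2 * p.2) ^ (-c)) + (Z p.1 p.2 ^ 2 * radialWeight p.1 ^ 2 * Real.sin (2 * p.2) ^ (-c))) := by ring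
  have h := abs_setIntegral_le_half_mul_add (f := fun p => X p.1 p.2 * Y p.1 p.2 * Z p.1 p.2 * radialWeight p.1 ^ 2 * Real.sin (2 * p.2) ^ (-c))
    (integrable_sqW hYt c) (integrable_sqW hZt c) hbd
  refine h.trans ?_
  have : B / 2 * ((∫ p in strip, Y p.1 p.2 ^ 2 * radialWeight p.1 ^ 2 * Real.sin (2 * p.2) ^ (-c)) +
      ∫ p in strip, Z p.1 p.2 ^ 2 * radialWeight p.1 ^ 2 * Real.sin (2 * p.2) ^ (-c)) ≤ B / 2 * ((eHkNormSq α 4 g).toReal + (eHkNormSq α 4 g).toReal) :=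
    mul_le_mul_of_nonneg_left (add_le_add hIY hIZ) (by positivity)
  linarith

/-- **The `D_θ`-transport word pairing with a bounded velocity** (Elgindi Lemma 8.9 / EGM
Proposition 9.5, one word): for `u ∈ C^∞(strip)` with `|D_θ^iD_z^ju| ≤ B` a.e. on the strip
(`i + j ≤ 4`), a test function `g`, `|a| ≤ 4`, `c ∈ {0,η,γ}` with `c = γ ⇒ a₁ ≥ 1`:
`|∫∫ D^a(uD_θg)·D^ag·w²s^{−c}| ≤ 12800·B·|g|²_{𝓗⁴}`. [cite: ElgindiGhoulMasmoudi2021, §9 Proposition 9.5 (p. 20 of arXiv:1910.14071); Elgindi2021, §8.2 Lemma 8.9 (p. 26 of arXiv:1904.04795)] -/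
theorem abs_wordPairing_Dθ_sup_le (hB : ∀ᵐ p ∂(volume.restrict strip), ∀ i j : ℕ, i + j ≤ 4 → |(Dθ^[i] (Dz^[j] u)) p.1 p.2| ≤ B)
    {a₁ a₂ : ℕ} (ha : a₁ + a₂ ≤ 4) {c : ℝ} (hc : c = 0 ∨ c = eta ∨ c = gammaExp α) (hgood : c = gammaExp α → 1 ≤ a₁) :
    |∫ p in strip, (Dθ^[a₁] (Dz^[a₂] (u * Dθ g))) p.1 p.2 * (Dθ^[a₁] (Dz^[a₂] g)) p.1 p.2 * radialWeight p.1 ^ 2 * Real.sin (2 * p.2) ^ (-c)| ≤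
      12800 * B * (eHkNormSq α 4 g).toReal := by
  set Eg := (eHkNormSq α 4 g).toReal with hEg
  have hEg0 : 0 ≤ Eg := ENNReal.toReal_nonneg
  have hc1 : |1 - c| ≤ 1 := by
    have hγ2 : gammaExp α ≤ 2 := by unfold gammaExp; linarith
    have hγ1 : 1 ≤ gammaExp α := by unfold gammaExp; linarith
    rcases hc with h | h | h <;> rw [h] <;> [norm_num; (unfold eta; norm_num); (rw [abs_le]; constructor <;> linarith)]
  -- everywhere bounds on the strip for the words of `u`
  have hu4 : ContDiffOn ℝ 4 (uncurry u) strip := hu.of_le (WithTop.coe_le_coe.2 le_top : (4 : WithTop ℕ∞) ≤ ((⊤ : ℕ∞) : WithTop ℕ∞))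
  have hXb : ∀ i j : ℕ, i + j ≤ 4 → ∀ p ∈ strip, |(Dθ^[i] (Dz^[j] u)) p.1 p.2| ≤ B := by
    intro i j hij
    have hcont : ContinuousOn (fun p : ℝ × ℝ => |(Dθ^[i] (Dz^[j] u)) p.1 p.2|) strip :=
      (continuousOn_iterate_Dθ_Dz hu4 hij).norm
    exact le_of_ae_le_strip hcont (hB.mono fun p hp => hp i j hij)
  have hgθ : ContDiffOn ℝ ∞ (uncurry (Dθ g)) strip := (contDiff_infty.2 hg.ofDθ.smooth).contDiffOn
  set Z := Dθ^[a₁] (Dz^[a₂] g) with hZ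
  -- the terms of the Leibniz expansion
  set term : ℕ → ℕ → ℝ := fun k l => ∫ p in strip, (Dθ^[l] (Dz^[k] u)) p.1 p.2 * (Dθ^[a₁ - l + 1] (Dz^[a₂ - k] g)) p.1 p.2 * Z p.1 p.2 *
    radialWeight p.1 ^ 2 * Real.sin (2 * p.2) ^ (-c) with hterm
  have hint : ∀ k l : ℕ, Integrable (fun p : ℝ × ℝ => (Dθ^[l] (Dz^[k] u)) p.1 p.2 * (Dθ^[a₁ - l + 1] (Dz^[a₂ - k] g)) p.1 p.2 * Z p.1 p.2 *
      radialWeight p.1 ^ 2 * Real.sin (2 * p.2) ^ (-c)) (volume.restrict strip) :=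
    fun k l => integrable_XYZW_smooth (contDiffOn_word_strip_infty hu l k) (hg.ofWord _ _) (hg.ofWord a₁ a₂) c
  have hexp : ∫ p in strip, (Dθ^[a₁] (Dz^[a₂] (u * Dθ g))) p.1 p.2 * Z p.1 p.2 * radialWeight p.1 ^ 2 * Real.sin (2 * p.2) ^ (-c) =
      ∑ k ∈ range (a₂ + 1), ∑ l ∈ range (a₁ + 1), ((a₂.choose k : ℝ) * (a₁.choose l : ℝ)) * term k l := by
    have e1 : ∀ p ∈ strip, (Dθ^[a₁] (Dz^[a₂] (u * Dθ g))) p.1 p.2 * Z p.1 p.2 * radialWeight p.1 ^ 2 * Real.sin (2 * p.2) ^ (-c) =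
        ∑ k ∈ range (a₂ + 1), ∑ l ∈ range (a₁ + 1), ((a₂.choose k : ℝ) * (a₁.choose l : ℝ)) *
          ((Dθ^[l] (Dz^[k] u)) p.1 p.2 * (Dθ^[a₁ - l + 1] (Dz^[a₂ - k] g)) p.1 p.2 * Z p.1 p.2 * radialWeight p.1 ^ 2 * Real.sin (2 * p.2) ^ (-c)) := by
      intro p hp
      rw [iterate_Dθ_Dz_mul_strip hu hgθ a₁ a₂ hp, Finset.sum_mul, Finset.sum_mul, Finset.sum_mul]
      refine Finset.sum_congr rfl fun k _ => ?_
      rw [Finset.sum_mul, Finset.sum_mul, Finset.sum_mul]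
      refine Finset.sum_congr rfl fun l _ => ?_
      rw [word_Dθ_strip hg (a₁ - l) (a₂ - k) hp]; ring
    rw [setIntegral_congr_fun measurableSet_strip e1, integral_finsetSum _ fun k _ => ?_]
    · refine Finset.sum_congr rfl fun k _ => ?_
      rw [integral_finsetSum _ fun l _ => ?_]
      · refine Finset.sum_congr rfl fun l _ => ?_
        rw [MeasureTheory.integral_const_mul]
      · exact (hint k l).const_mul _
    · exact integrable_finsetSum _ fun l _ => (hint k l).const_mul _
  -- every term is bounded by `2·B·Eg`
  have hbd : ∀ k ∈ range (a₂ + 1), ∀ l ∈ range (a₁ + 1), |term k l| ≤ 2 * B * Eg := by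
    intro k hk l hl
    have hk' : k ≤ a₂ := Nat.lt_succ_iff.1 (mem_range.1 hk)
    have hl' : l ≤ a₁ := Nat.lt_succ_iff.1 (mem_range.1 hl)
    by_cases h00 : l = 0 ∧ k = 0
    · obtain ⟨rfl, rfl⟩ := h00
      have h0 : ∀ p ∈ strip, |u p.1 p.2| ≤ B := fun p hp => by simpa using hXb 0 0 (by norm_num) p hp
      have h1 : ∀ p ∈ strip, |Dθ u p.1 p.2| ≤ B := fun p hp => by simpa using hXb 1 0 (by norm_num) p hp
      have h := abs_integral_ibp_Dθ_sup_le hα hα10 hu hg hB0 h0 h1 ha hc hgood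
      have e : term 0 0 = ∫ p in strip, u p.1 p.2 * Dθ (Dθ^[a₁] (Dz^[a₂] g)) p.1 p.2 * (Dθ^[a₁] (Dz^[a₂] g)) p.1 p.2 * radialWeight p.1 ^ 2 * Real.sin (2 * p.2) ^ (-c) := by
        simp only [hterm, hZ, Nat.sub_zero, Function.iterate_zero, id_eq, Function.iterate_succ_apply']
      rw [e]
      refine h.trans ?_
      have : (1 / 2 + |1 - c|) * B * Eg ≤ 2 * B * Eg :=
        mul_le_mul_of_nonneg_right (mul_le_mul_of_nonneg_right (by linarith) hB0) hEg0
      exact this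
    · have h := abs_integral_cross_Dθ_sup_le hα hα10 hg hB0 ha hl' hk' h00 (hXb l k (by omega)) hc hgood
      refine h.trans ?_
      nlinarith
  rw [hexp]
  calc |∑ k ∈ range (a₂ + 1), ∑ l ∈ range (a₁ + 1), ((a₂.choose k : ℝ) * (a₁.choose l : ℝ)) * term k l|
      ≤ ∑ k ∈ range (a₂ + 1), ∑ l ∈ range (a₁ + 1), |((a₂.choose k : ℝ) * (a₁.choose l : ℝ)) * term k l| := by
        refine (Finset.abs_sum_le_sum_abs _ _).trans (Finset.sum_le_sum fun k _ => Finset.abs_sum_le_sum_abs _ _)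
    _ ≤ ∑ k ∈ range (a₂ + 1), ∑ l ∈ range (a₁ + 1), 256 * (2 * B * Eg) := by
        refine Finset.sum_le_sum fun k hk => Finset.sum_le_sum fun l hl => ?_
        rw [abs_mul]
        refine mul_le_mul ?_ (hbd k hk l hl) (abs_nonneg _) (by norm_num)
        rw [abs_of_nonneg (by positivity)]
        calc (a₂.choose k : ℝ) * (a₁.choose l : ℝ) ≤ 16 * 16 := mul_le_mul (choose_le_sixteen (by omega)) (choose_le_sixteen (by omega)) (by positivity) (by norm_num)
          _ = 256 := by norm_num
    _ = ((a₂ + 1 : ℕ) : ℝ) * (((a₁ + 1 : ℕ) : ℝ) * (256 * (2 * B * Eg))) := by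
        rw [Finset.sum_const, Finset.card_range, nsmul_eq_mul, Finset.sum_const, Finset.card_range, nsmul_eq_mul]
    _ ≤ 5 * (5 * (256 * (2 * B * Eg))) := by
        have h5a : ((a₂ + 1 : ℕ) : ℝ) ≤ 5 := by exact_mod_cast (by omega : a₂ + 1 ≤ 5)
        have h5b : ((a₁ + 1 : ℕ) : ℝ) ≤ 5 := by exact_mod_cast (by omega : a₁ + 1 ≤ 5)
        have h0 : 0 ≤ 2 * B * Eg := by positivity
        exact mul_le_mul h5a (mul_le_mul h5b le_rfl (by positivity) (by norm_num)) (by positivity) (by norm_num)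
    _ = 12800 * B * Eg := by ring

/-! ### The `D_z`-transport word pairing with a bounded velocity -/

/-- **The integration-by-parts term of the `D_z`-transport, bounded velocity**:
`|∫∫ v·D_z(D^ag)·D^ag·w²s^{−c}| ≤ 2B·E(g)` when `|v|, |D_zv| ≤ B` on the strip
(`|(z−3)/(1+z)| ≤ 3`). [cite: Elgindi2021, §8.2 Lemma 8.9 (p. 26 of arXiv:1904.04795)] -/
theorem abs_integral_ibp_Dz_sup_le (h0 : ∀ p ∈ strip, |u p.1 p.2| ≤ B) (h1 : ∀ p ∈ strip, |Dz u p.1 p.2| ≤ B)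
    {a₁ a₂ : ℕ} (ha : a₁ + a₂ ≤ 4) {c : ℝ} (hc : c = 0 ∨ c = eta ∨ c = gammaExp α) (hgood : c = gammaExp α → 1 ≤ a₁) :
    |∫ p in strip, u p.1 p.2 * Dz (Dθ^[a₁] (Dz^[a₂] g)) p.1 p.2 * (Dθ^[a₁] (Dz^[a₂] g)) p.1 p.2 * radialWeight p.1 ^ 2 * Real.sin (2 * p.2) ^ (-c)| ≤
      2 * B * (eHkNormSq α 4 g).toReal := by
  set Z := Dθ^[a₁] (Dz^[a₂] g) with hZdef
  have hZ : StripTest Z := hg.ofWord a₁ a₂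
  rw [integral_transport_Dz_smooth hu hZ c, abs_mul, show |(-(1 / 2) : ℝ)| = 1 / 2 by norm_num]
  have hI := integral_wordZ_le hα hα10 hg ha hc hgood
  have hi := integrable_sqW hZ c
  have hbound : ∀ p ∈ strip, |Z p.1 p.2 ^ 2 * radialWeight p.1 ^ 2 * Real.sin (2 * p.2) ^ (-c) * (Dz u p.1 p.2 + (p.1 - 3) / (1 + p.1) * u p.1 p.2)| ≤
      (4 * B) * (Z p.1 p.2 ^ 2 * radialWeight p.1 ^ 2 * Real.sin (2 * p.2) ^ (-c)) := by
    intro p hp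
    have hz : 0 < p.1 := hp.1
    have hs : 0 < Real.sin (2 * p.2) := Real.sin_pos_of_pos_of_lt_pi (by linarith [hp.2.1]) (by linarith [hp.2.2])
    have hW : 0 ≤ Z p.1 p.2 ^ 2 * radialWeight p.1 ^ 2 * Real.sin (2 * p.2) ^ (-c) := by
      have := Real.rpow_nonneg hs.le (-c); positivity
    have hq : |(p.1 - 3) / (1 + p.1)| ≤ 3 := by
      rw [abs_div, abs_of_pos (by linarith : (0:ℝ) < 1 + p.1), div_le_iff₀ (by linarith : (0:ℝ) < 1 + p.1), abs_le]
      constructor <;> linarith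
    rw [abs_mul, abs_of_nonneg hW, mul_comm]
    refine mul_le_mul_of_nonneg_right ?_ hW
    calc |Dz u p.1 p.2 + (p.1 - 3) / (1 + p.1) * u p.1 p.2| ≤ |Dz u p.1 p.2| + |(p.1 - 3) / (1 + p.1) * u p.1 p.2| := abs_add_le _ _
      _ ≤ B + 3 * B := by
          refine add_le_add (h1 p hp) ?_
          rw [abs_mul]
          exact mul_le_mul hq (h0 p hp) (abs_nonneg _) (by norm_num)
      _ = 4 * B := by ring
  have hle := norm_integral_le_of_norm_le (hi.const_mul (4 * B))
    ((ae_restrict_iff' measurableSet_strip).2 (ae_of_all _ fun p hp => by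
      rw [Real.norm_eq_abs]; exact hbound p hp))
  rw [Real.norm_eq_abs, MeasureTheory.integral_const_mul] at hle
  calc 1 / 2 * |∫ p in strip, Z p.1 p.2 ^ 2 * radialWeight p.1 ^ 2 * Real.sin (2 * p.2) ^ (-c) * (Dz u p.1 p.2 + (p.1 - 3) / (1 + p.1) * u p.1 p.2)|
      ≤ 1 / 2 * ((4 * B) * ∫ p in strip, Z p.1 p.2 ^ 2 * radialWeight p.1 ^ 2 * Real.sin (2 * p.2) ^ (-c)) :=
        mul_le_mul_of_nonneg_left hle (by norm_num)
    _ ≤ 1 / 2 * ((4 * B) * (eHkNormSq α 4 g).toReal) :=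
        mul_le_mul_of_nonneg_left (mul_le_mul_of_nonneg_left hI (by positivity)) (by norm_num)
    _ = 2 * B * (eHkNormSq α 4 g).toReal := by ring

omit hu in
/-- **The cross terms of the `D_z`-transport, velocity with vanishing angular words**:
`|∫∫ X·Y·Z·w²s^{−c}| ≤ B·E(g)` for `X = D^{(l,k)}v` with `|X| ≤ B` (`l = 0`) resp. `|X| ≤ B sin 2θ`
(`l ≥ 1`) on the strip, `Y = D_θ^{a₁−l}D_z^{a₂−k+1}g`, `Z = D^ag`, `(l,k) ≠ (0,0)`. When `l = a₁ ≥ 1`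
the word `Y` is radial and only carries the weight `sin(2θ)^{−η}`; the factor `sin 2θ` of `X`
restores it: `sin²(2θ)·s^{−c} ≤ s^{−η}`. [cite: Elgindi2021, §8.2 Lemma 8.9 (p. 26 of arXiv:1904.04795)] -/
theorem abs_integral_cross_Dz_sup_le {a₁ a₂ l k : ℕ} (ha : a₁ + a₂ ≤ 4) (hl : l ≤ a₁) (hk : k ≤ a₂) (hlk : ¬(l = 0 ∧ k = 0))
    (hX : ∀ p ∈ strip, |(Dθ^[l] (Dz^[k] u)) p.1 p.2| ≤ (if l = 0 then 1 else Real.sin (2 * p.2)) * B)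
    {c : ℝ} (hc : c = 0 ∨ c = eta ∨ c = gammaExp α) (hgood : c = gammaExp α → 1 ≤ a₁) :
    |∫ p in strip, (Dθ^[l] (Dz^[k] u)) p.1 p.2 * (Dθ^[a₁ - l] (Dz^[a₂ - k + 1] g)) p.1 p.2 * (Dθ^[a₁] (Dz^[a₂] g)) p.1 p.2 *
        radialWeight p.1 ^ 2 * Real.sin (2 * p.2) ^ (-c)| ≤ B * (eHkNormSq α 4 g).toReal := by
  set X := Dθ^[l] (Dz^[k] u) with hXd
  set Y := Dθ^[a₁ - l] (Dz^[a₂ - k + 1] g) with hY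
  set Z := Dθ^[a₁] (Dz^[a₂] g) with hZ'
  have hYt : StripTest Y := hg.ofWord _ _
  have hZt : StripTest Z := hg.ofWord a₁ a₂
  have hIZ : ∫ p in strip, Z p.1 p.2 ^ 2 * radialWeight p.1 ^ 2 * Real.sin (2 * p.2) ^ (-c) ≤ (eHkNormSq α 4 g).toReal :=
    integral_wordZ_le hα hα10 hg ha hc hgood
  -- the weight exponent used for `Y`: `c` unless `l = a₁ ≥ 1`, where it is `η`
  set c' : ℝ := if l = a₁ ∧ 1 ≤ l then eta else c with hc'
  have hc'mem : c' = 0 ∨ c' = eta ∨ c' = gammaExp α := by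
    rw [hc']; split_ifs
    · exact Or.inr (Or.inl rfl)
    · exact hc
  have hIY : ∫ p in strip, Y p.1 p.2 ^ 2 * radialWeight p.1 ^ 2 * Real.sin (2 * p.2) ^ (-c') ≤ (eHkNormSq α 4 g).toReal := by
    refine integral_wordZ_le hα hα10 hg (a₁ := a₁ - l) (a₂ := a₂ - k + 1) (by omega) hc'mem (fun h => ?_)
    rw [hc'] at h
    split_ifs at h with hcase
    · exact absurd h (by unfold eta gammaExp; intro h'; linarith)
    · have := hgood h
      omega
  -- the pointwise bound `|X·Y·Z|W_c ≤ (B/2)(Y²W_{c'} + Z²W_c)`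
  have hbd : ∀ p ∈ strip, |X p.1 p.2 * Y p.1 p.2 * Z p.1 p.2 * radialWeight p.1 ^ 2 * Real.sin (2 * p.2) ^ (-c)| ≤
      B / 2 * ((Y p.1 p.2 ^ 2 * radialWeight p.1 ^ 2 * Real.sin (2 * p.2) ^ (-c')) + (Z p.1 p.2 ^ 2 * radialWeight p.1 ^ 2 * Real.sin (2 * p.2) ^ (-c))) := by
    intro p hp
    have hs : 0 < Real.sin (2 * p.2) := Real.sin_pos_of_pos_of_lt_pi (by linarith [hp.2.1]) (by linarith [hp.2.2])
    have hs1 : Real.sin (2 * p.2) ≤ 1 := Real.sin_le_one _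
    have hrc : 0 ≤ Real.sin (2 * p.2) ^ (-c) := Real.rpow_nonneg hs.le (-c)
    have hw2 : 0 ≤ radialWeight p.1 ^ 2 := sq_nonneg _
    have hWnn : 0 ≤ radialWeight p.1 ^ 2 * Real.sin (2 * p.2) ^ (-c) := mul_nonneg hw2 hrc
    have hx := hX p hp
    have eabs : |X p.1 p.2 * Y p.1 p.2 * Z p.1 p.2 * radialWeight p.1 ^ 2 * Real.sin (2 * p.2) ^ (-c)| =
        |X p.1 p.2| * (|Y p.1 p.2| * |Z p.1 p.2|) * (radialWeight p.1 ^ 2 * Real.sin (2 * p.2) ^ (-c)) := by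
      rw [show X p.1 p.2 * Y p.1 p.2 * Z p.1 p.2 * radialWeight p.1 ^ 2 * Real.sin (2 * p.2) ^ (-c) =
        (X p.1 p.2 * (Y p.1 p.2 * Z p.1 p.2)) * (radialWeight p.1 ^ 2 * Real.sin (2 * p.2) ^ (-c)) by ring,
        abs_mul, abs_mul, abs_mul, abs_of_nonneg hWnn]
    rw [eabs]
    by_cases hcase : l = a₁ ∧ 1 ≤ l
    · -- `|X| ≤ sB`: `|X||Y||Z| ≤ B·(s|Y|)|Z| ≤ (B/2)(s²Y² + Z²)` and `s²s^{−c} ≤ s^{−η}`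
      have hc'η : c' = eta := by rw [hc', if_pos hcase]
      have hl0 : l ≠ 0 := by omega
      rw [if_neg hl0] at hx
      have h2 : (Real.sin (2 * p.2) * |Y p.1 p.2|) * |Z p.1 p.2| ≤ (Real.sin (2 * p.2) ^ 2 * Y p.1 p.2 ^ 2 + Z p.1 p.2 ^ 2) / 2 := by
        nlinarith [sq_nonneg (Real.sin (2 * p.2) * |Y p.1 p.2| - |Z p.1 p.2|), sq_abs (Y p.1 p.2), sq_abs (Z p.1 p.2)]
      have hsc := sin_sq_mul_rpow_le_rpow_neg_eta hα10 hc hp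
      calc |X p.1 p.2| * (|Y p.1 p.2| * |Z p.1 p.2|) * (radialWeight p.1 ^ 2 * Real.sin (2 * p.2) ^ (-c))
          ≤ (Real.sin (2 * p.2) * B) * (|Y p.1 p.2| * |Z p.1 p.2|) * (radialWeight p.1 ^ 2 * Real.sin (2 * p.2) ^ (-c)) :=
            mul_le_mul_of_nonneg_right (mul_le_mul_of_nonneg_right hx (mul_nonneg (abs_nonneg _) (abs_nonneg _))) hWnn
        _ = B * ((Real.sin (2 * p.2) * |Y p.1 p.2|) * |Z p.1 p.2|) * (radialWeight p.1 ^ 2 * Real.sin (2 * p.2) ^ (-c)) := by ring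
        _ ≤ B * ((Real.sin (2 * p.2) ^ 2 * Y p.1 p.2 ^ 2 + Z p.1 p.2 ^ 2) / 2) * (radialWeight p.1 ^ 2 * Real.sin (2 * p.2) ^ (-c)) :=
            mul_le_mul_of_nonneg_right (mul_le_mul_of_nonneg_left h2 hB0) hWnn
        _ = B / 2 * (Y p.1 p.2 ^ 2 * radialWeight p.1 ^ 2 * (Real.sin (2 * p.2) ^ 2 * Real.sin (2 * p.2) ^ (-c)) +
              Z p.1 p.2 ^ 2 * radialWeight p.1 ^ 2 * Real.sin (2 * p.2) ^ (-c)) := by ring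
        _ ≤ B / 2 * (Y p.1 p.2 ^ 2 * radialWeight p.1 ^ 2 * Real.sin (2 * p.2) ^ (-c') + Z p.1 p.2 ^ 2 * radialWeight p.1 ^ 2 * Real.sin (2 * p.2) ^ (-c)) := by
            rw [hc'η]
            refine mul_le_mul_of_nonneg_left (add_le_add (mul_le_mul_of_nonneg_left hsc (by positivity : (0:ℝ) ≤ Y p.1 p.2 ^ 2 * radialWeight p.1 ^ 2)) le_rfl) (by positivity)
    · -- `|X| ≤ B` (for `l ≥ 1` via `s ≤ 1`), `c' = c`
      have hc'c : c' = c := by rw [hc', if_neg hcase]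
      have hx' : |X p.1 p.2| ≤ B := by
        refine hx.trans ?_
        split_ifs
        · rw [one_mul]
        · exact (mul_le_of_le_one_left hB0 hs1)
      have h2 : |Y p.1 p.2| * |Z p.1 p.2| ≤ (Y p.1 p.2 ^ 2 + Z p.1 p.2 ^ 2) / 2 := by
        nlinarith [sq_nonneg (|Y p.1 p.2| - |Z p.1 p.2|), sq_abs (Y p.1 p.2), sq_abs (Z p.1 p.2)]
      rw [hc'c]
      calc |X p.1 p.2| * (|Y p.1 p.2| * |Z p.1 p.2|) * (radialWeight p.1 ^ 2 * Real.sin (2 * p.2) ^ (-c))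
          ≤ B * ((Y p.1 p.2 ^ 2 + Z p.1 p.2 ^ 2) / 2) * (radialWeight p.1 ^ 2 * Real.sin (2 * p.2) ^ (-c)) := by
            refine mul_le_mul_of_nonneg_right ?_ hWnn
            exact mul_le_mul hx' h2 (mul_nonneg (abs_nonneg _) (abs_nonneg _)) hB0
        _ = B / 2 * ((Y p.1 p.2 ^ 2 * radialWeight p.1 ^ 2 * Real.sin (2 * p.2) ^ (-c)) + (Z p.1 p.2 ^ 2 * radialWeight p.1 ^ 2 * Real.sin (2 * p.2) ^ (-c))) := by ring
  have h := abs_setIntegral_le_half_mul_add (f := fun p => X p.1 p.2 * Y p.1 p.2 * Z p.1 p.2 * radialWeight p.1 ^ 2 * Real.sin (2 * p.2) ^ (-c))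
    (integrable_sqW hYt c') (integrable_sqW hZt c) hbd
  refine h.trans ?_
  have : B / 2 * ((∫ p in strip, Y p.1 p.2 ^ 2 * radialWeight p.1 ^ 2 * Real.sin (2 * p.2) ^ (-c')) +
      ∫ p in strip, Z p.1 p.2 ^ 2 * radialWeight p.1 ^ 2 * Real.sin (2 * p.2) ^ (-c)) ≤ B / 2 * ((eHkNormSq α 4 g).toReal + (eHkNormSq α 4 g).toReal) :=
    mul_le_mul_of_nonneg_left (add_le_add hIY hIZ) (by positivity)
  linarith

/-- **The `D_z`-transport word pairing with a velocity whose angular words vanish at the boundary**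
(Elgindi Lemma 8.9 / EGM Proposition 9.5, one word): for `v ∈ C^∞(strip)` with, a.e. on the strip,
`|D_z^jv| ≤ B` and `|D_θ^iD_z^jv| ≤ B·sin 2θ` (`i ≥ 1`, `i + j ≤ 4`), a test function `g`, `|a| ≤ 4`,
`c ∈ {0,η,γ}` with `c = γ ⇒ a₁ ≥ 1`: `|∫∫ D^a(vD_zg)·D^ag·w²s^{−c}| ≤ 12800·B·|g|²_{𝓗⁴}`. [cite: ElgindiGhoulMasmoudi2021, §9 Proposition 9.5 (p. 20 of arXiv:1910.14071); Elgindi2021, §8.2 Lemma 8.9 (p. 26 of arXiv:1904.04795)] -/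
theorem abs_wordPairing_Dz_sup_le (hB : ∀ᵐ p ∂(volume.restrict strip), ∀ i j : ℕ, i + j ≤ 4 →
      |(Dθ^[i] (Dz^[j] u)) p.1 p.2| ≤ (if i = 0 then 1 else Real.sin (2 * p.2)) * B)
    {a₁ a₂ : ℕ} (ha : a₁ + a₂ ≤ 4) {c : ℝ} (hc : c = 0 ∨ c = eta ∨ c = gammaExp α) (hgood : c = gammaExp α → 1 ≤ a₁) :
    |∫ p in strip, (Dθ^[a₁] (Dz^[a₂] (u * Dz g))) p.1 p.2 * (Dθ^[a₁] (Dz^[a₂] g)) p.1 p.2 * radialWeight p.1 ^ 2 * Real.sin (2 * p.2) ^ (-c)| ≤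
      12800 * B * (eHkNormSq α 4 g).toReal := by
  set Eg := (eHkNormSq α 4 g).toReal with hEg
  have hEg0 : 0 ≤ Eg := ENNReal.toReal_nonneg
  -- everywhere bounds on the strip for the words of `u`
  have hu4 : ContDiffOn ℝ 4 (uncurry u) strip := hu.of_le (WithTop.coe_le_coe.2 le_top : (4 : WithTop ℕ∞) ≤ ((⊤ : ℕ∞) : WithTop ℕ∞))
  have hXb : ∀ i j : ℕ, i + j ≤ 4 → ∀ p ∈ strip, |(Dθ^[i] (Dz^[j] u)) p.1 p.2| ≤ (if i = 0 then 1 else Real.sin (2 * p.2)) * B := by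
    intro i j hij
    have hcont : ContinuousOn (fun p : ℝ × ℝ => |(Dθ^[i] (Dz^[j] u)) p.1 p.2| - (if i = 0 then 1 else Real.sin (2 * p.2)) * B) strip := by
      refine (continuousOn_iterate_Dθ_Dz hu4 hij).norm.sub (ContinuousOn.mul ?_ continuousOn_const)
      split_ifs
      · exact continuousOn_const
      · exact (Real.continuous_sin.comp (continuous_const.mul continuous_snd)).continuousOn
    have h := le_of_ae_le_strip (M := 0) hcont (hB.mono fun p hp => by have := hp i j hij; linarith)
    intro p hp; have := h p hp; linarith
  have hgz : ContDiffOn ℝ ∞ (uncurry (Dz g)) strip := (contDiff_infty.2 hg.ofDz.smooth).contDiffOn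
  set Z := Dθ^[a₁] (Dz^[a₂] g) with hZ
  -- the terms of the Leibniz expansion
  set term : ℕ → ℕ → ℝ := fun k l => ∫ p in strip, (Dθ^[l] (Dz^[k] u)) p.1 p.2 * (Dθ^[a₁ - l] (Dz^[a₂ - k + 1] g)) p.1 p.2 * Z p.1 p.2 *
    radialWeight p.1 ^ 2 * Real.sin (2 * p.2) ^ (-c) with hterm
  have hint : ∀ k l : ℕ, Integrable (fun p : ℝ × ℝ => (Dθ^[l] (Dz^[k] u)) p.1 p.2 * (Dθ^[a₁ - l] (Dz^[a₂ - k + 1] g)) p.1 p.2 * Z p.1 p.2 *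
      radialWeight p.1 ^ 2 * Real.sin (2 * p.2) ^ (-c)) (volume.restrict strip) :=
    fun k l => integrable_XYZW_smooth (contDiffOn_word_strip_infty hu l k) (hg.ofWord _ _) (hg.ofWord a₁ a₂) c
  have hexp : ∫ p in strip, (Dθ^[a₁] (Dz^[a₂] (u * Dz g))) p.1 p.2 * Z p.1 p.2 * radialWeight p.1 ^ 2 * Real.sin (2 * p.2) ^ (-c) =
      ∑ k ∈ range (a₂ + 1), ∑ l ∈ range (a₁ + 1), ((a₂.choose k : ℝ) * (a₁.choose l : ℝ)) * term k l := by
    have e1 : ∀ p ∈ strip, (Dθ^[a₁] (Dz^[a₂] (u * Dz g))) p.1 p.2 * Z p.1 p.2 * radialWeight p.1 ^ 2 * Real.sin (2 * p.2) ^ (-c) =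
        ∑ k ∈ range (a₂ + 1), ∑ l ∈ range (a₁ + 1), ((a₂.choose k : ℝ) * (a₁.choose l : ℝ)) *
          ((Dθ^[l] (Dz^[k] u)) p.1 p.2 * (Dθ^[a₁ - l] (Dz^[a₂ - k + 1] g)) p.1 p.2 * Z p.1 p.2 * radialWeight p.1 ^ 2 * Real.sin (2 * p.2) ^ (-c)) := by
      intro p hp
      rw [iterate_Dθ_Dz_mul_strip hu hgz a₁ a₂ hp, Finset.sum_mul, Finset.sum_mul, Finset.sum_mul]
      refine Finset.sum_congr rfl fun k _ => ?_
      rw [Finset.sum_mul, Finset.sum_mul, Finset.sum_mul]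
      refine Finset.sum_congr rfl fun l _ => ?_
      rw [← Function.iterate_succ_apply Dz (a₂ - k) g]; ring
    rw [setIntegral_congr_fun measurableSet_strip e1, integral_finsetSum _ fun k _ => ?_]
    · refine Finset.sum_congr rfl fun k _ => ?_
      rw [integral_finsetSum _ fun l _ => ?_]
      · refine Finset.sum_congr rfl fun l _ => ?_
        rw [MeasureTheory.integral_const_mul]
      · exact (hint k l).const_mul _
    · exact integrable_finsetSum _ fun l _ => (hint k l).const_mul _
  -- every term is bounded by `2·B·Eg`
  have hbd : ∀ k ∈ range (a₂ + 1), ∀ l ∈ range (a₁ + 1), |term k l| ≤ 2 * B * Eg := by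
    intro k hk l hl
    have hk' : k ≤ a₂ := Nat.lt_succ_iff.1 (mem_range.1 hk)
    have hl' : l ≤ a₁ := Nat.lt_succ_iff.1 (mem_range.1 hl)
    by_cases h00 : l = 0 ∧ k = 0
    · obtain ⟨rfl, rfl⟩ := h00
      have h0 : ∀ p ∈ strip, |u p.1 p.2| ≤ B := fun p hp => by simpa using hXb 0 0 (by norm_num) p hp
      have h1 : ∀ p ∈ strip, |Dz u p.1 p.2| ≤ B := fun p hp => by simpa using hXb 0 1 (by norm_num) p hp
      have h := abs_integral_ibp_Dz_sup_le hα hα10 hu hg hB0 h0 h1 ha hc hgood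
      have e : term 0 0 = ∫ p in strip, u p.1 p.2 * Dz (Dθ^[a₁] (Dz^[a₂] g)) p.1 p.2 * (Dθ^[a₁] (Dz^[a₂] g)) p.1 p.2 * radialWeight p.1 ^ 2 * Real.sin (2 * p.2) ^ (-c) := by
        simp only [hterm, hZ, Nat.sub_zero, Function.iterate_zero, id_eq]
        refine setIntegral_congr_fun measurableSet_strip fun p hp => ?_
        rw [Dz_word_strip hg a₁ a₂ hp]
      rw [e]
      exact h
    · have h := abs_integral_cross_Dz_sup_le hα hα10 hg hB0 ha hl' hk' h00 (hXb l k (by omega)) hc hgood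
      refine h.trans ?_
      nlinarith
  rw [hexp]
  calc |∑ k ∈ range (a₂ + 1), ∑ l ∈ range (a₁ + 1), ((a₂.choose k : ℝ) * (a₁.choose l : ℝ)) * term k l|
      ≤ ∑ k ∈ range (a₂ + 1), ∑ l ∈ range (a₁ + 1), |((a₂.choose k : ℝ) * (a₁.choose l : ℝ)) * term k l| := by
        refine (Finset.abs_sum_le_sum_abs _ _).trans (Finset.sum_le_sum fun k _ => Finset.abs_sum_le_sum_abs _ _)
    _ ≤ ∑ k ∈ range (a₂ + 1), ∑ l ∈ range (a₁ + 1), 256 * (2 * B * Eg) := by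
        refine Finset.sum_le_sum fun k hk => Finset.sum_le_sum fun l hl => ?_
        rw [abs_mul]
        refine mul_le_mul ?_ (hbd k hk l hl) (abs_nonneg _) (by norm_num)
        rw [abs_of_nonneg (by positivity)]
        calc (a₂.choose k : ℝ) * (a₁.choose l : ℝ) ≤ 16 * 16 := mul_le_mul (choose_le_sixteen (by omega)) (choose_le_sixteen (by omega)) (by positivity) (by norm_num)
          _ = 256 := by norm_num
    _ = ((a₂ + 1 : ℕ) : ℝ) * (((a₁ + 1 : ℕ) : ℝ) * (256 * (2 * B * Eg))) := by
        rw [Finset.sum_const, Finset.card_range, nsmul_eq_mul, Finset.sum_const, Finset.card_range, nsmul_eq_mul]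
    _ ≤ 5 * (5 * (256 * (2 * B * Eg))) := by
        have h5a : ((a₂ + 1 : ℕ) : ℝ) ≤ 5 := by exact_mod_cast (by omega : a₂ + 1 ≤ 5)
        have h5b : ((a₁ + 1 : ℕ) : ℝ) ≤ 5 := by exact_mod_cast (by omega : a₁ + 1 ≤ 5)
        have h0 : 0 ≤ 2 * B * Eg := by positivity
        exact mul_le_mul h5a (mul_le_mul h5b le_rfl (by positivity) (by norm_num)) (by positivity) (by norm_num)
    _ = 12800 * B * Eg := by ring

end pieces

/-! ### The `𝓗⁴`-type inner products `hkForm α 3 λ Λ` -/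

/-- **From word pairings to the inner products**: if every weighted word pairing of `F` against `g`
is bounded by `Bd` (`|a| ≤ 4`, `c ∈ {0,η,γ}`, `c = γ ⇒ a₁ ≥ 1`), then
`|hkForm α 3 λ Λ F g| ≤ (Σ_w |λ_w|(10 + |Λ_w|(10¹⁰ + 10¹⁷ + 10²¹)))·Bd` (the four pairings of each
block of [Elgindi2021] Definition 6.10 are word pairings of this kind). [cite: Elgindi2021, §6.2 Definition 6.10 and §6.3 Proposition 6.13 (p. 17–18 of arXiv:1904.04795)] -/
theorem abs_hkForm_le_of_wordPairing {α : ℝ} (hα : 0 < α) {F g : ℝ → ℝ → ℝ} (hFt : StripTest F) (hg : StripTest g) {Bd : ℝ}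
    (hpair : ∀ a₁ a₂ : ℕ, a₁ + a₂ ≤ 4 → ∀ c : ℝ, (c = 0 ∨ c = eta ∨ c = gammaExp α) → (c = gammaExp α → 1 ≤ a₁) →
      |∫ p in strip, (Dθ^[a₁] (Dz^[a₂] F)) p.1 p.2 * (Dθ^[a₁] (Dz^[a₂] g)) p.1 p.2 * radialWeight p.1 ^ 2 * Real.sin (2 * p.2) ^ (-c)| ≤ Bd)
    (lam Lam : ℕ × ℕ → ℝ) :
    |hkForm α 3 lam Lam F g| ≤ (∑ w ∈ WSet 3 3, |lam w| * (10 + |Lam w| * (10 ^ 10 + 10 ^ 17 + 10 ^ 21))) * Bd := by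
  have hη : (eta : ℝ) = 0 ∨ eta = eta ∨ eta = gammaExp α := Or.inr (Or.inl rfl)
  have hγ' : gammaExp α = 0 ∨ gammaExp α = eta ∨ gammaExp α = gammaExp α := Or.inr (Or.inr rfl)
  have h0' : (0:ℝ) = 0 ∨ (0:ℝ) = eta ∨ (0:ℝ) = gammaExp α := Or.inl rfl
  -- the four pairings of a block, as word pairings
  have hblock : ∀ w ∈ WSet 3 3, |blockΛ α (Lam w) (Dθ^[w.1] (Dz^[w.2] F)) (Dθ^[w.1] (Dz^[w.2] g))| ≤ (10 + |Lam w| * (10 ^ 10 + 10 ^ 17 + 10 ^ 21)) * Bd := by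
    intro w hw
    rw [mem_WSet_self] at hw
    obtain ⟨i, j⟩ := w
    simp only at hw ⊢
    -- (1) the `D_z`-extended `η`-pairing: word `(i, j+1)`
    have T1 : |pairW wEta (Dz (Dθ^[i] (Dz^[j] F))) (Dz (Dθ^[i] (Dz^[j] g)))| ≤ Bd := by
      have h := hpair i (j + 1) (by omega) eta hη (fun h => absurd h (by unfold eta gammaExp; intro h'; linarith))
      rw [pairW_def]
      refine le_of_eq_of_le ?_ h
      congr 1
      refine setIntegral_congr_fun measurableSet_strip fun p hp => ?_
      rw [Dz_word_strip hFt i j hp, Dz_word_strip hg i j hp]; rfl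
    -- (2) the `η`-pairing: word `(i, j)`
    have T2 : |pairW wEta (Dθ^[i] (Dz^[j] F)) (Dθ^[i] (Dz^[j] g))| ≤ Bd := by
      have h := hpair i j (by omega) eta hη (fun h => absurd h (by unfold eta gammaExp; intro h'; linarith))
      rw [pairW_def]; exact h
    -- (3) the unweighted pairing: word `(i, j)`, `c = 0`
    have T3 : |pairW (fun _ => (1:ℝ)) (Dθ^[i] (Dz^[j] F)) (Dθ^[i] (Dz^[j] g))| ≤ Bd := by
      have h := hpair i j (by omega) 0 h0' (fun h => by unfold gammaExp at h; linarith)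
      rw [pairW_def]
      refine le_of_eq_of_le ?_ h
      congr 1
      refine setIntegral_congr_fun measurableSet_strip fun p _ => ?_
      rw [neg_zero, Real.rpow_zero]
    -- (4) the `D_θ`-extended `γ`-pairing: word `(i+1, j)`
    have T4 : |pairW (wGam α) (Dθ (Dθ^[i] (Dz^[j] F))) (Dθ (Dθ^[i] (Dz^[j] g)))| ≤ Bd := by
      have h := hpair (i + 1) j (by omega) (gammaExp α) hγ' (fun _ => by omega)
      rw [pairW_def]
      refine le_of_eq_of_le ?_ h
      congr 1
      refine setIntegral_congr_fun measurableSet_strip fun p _ => ?_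
      simp only [wGam, Function.iterate_succ_apply']
    rw [blockΛ_def]
    have hΛ := abs_nonneg (Lam (i, j))
    calc |10 * pairW wEta (Dz (Dθ^[i] (Dz^[j] F))) (Dz (Dθ^[i] (Dz^[j] g))) +
          Lam (i, j) * (10 ^ 10 * pairW wEta (Dθ^[i] (Dz^[j] F)) (Dθ^[i] (Dz^[j] g)) + 10 ^ 17 * pairW (fun _ => 1) (Dθ^[i] (Dz^[j] F)) (Dθ^[i] (Dz^[j] g)) +
            10 ^ 21 * pairW (wGam α) (Dθ (Dθ^[i] (Dz^[j] F))) (Dθ (Dθ^[i] (Dz^[j] g))))|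
        ≤ 10 * |pairW wEta (Dz (Dθ^[i] (Dz^[j] F))) (Dz (Dθ^[i] (Dz^[j] g)))| +
          |Lam (i, j)| * (10 ^ 10 * |pairW wEta (Dθ^[i] (Dz^[j] F)) (Dθ^[i] (Dz^[j] g))| + 10 ^ 17 * |pairW (fun _ => 1) (Dθ^[i] (Dz^[j] F)) (Dθ^[i] (Dz^[j] g))| +
            10 ^ 21 * |pairW (wGam α) (Dθ (Dθ^[i] (Dz^[j] F))) (Dθ (Dθ^[i] (Dz^[j] g)))|) := by
          refine (abs_add_le _ _).trans (add_le_add ?_ ?_)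
          · rw [abs_mul, show |(10:ℝ)| = 10 by norm_num]
          · rw [abs_mul]
            refine mul_le_mul_of_nonneg_left ((abs_add_le _ _).trans (add_le_add ((abs_add_le _ _).trans (add_le_add ?_ ?_)) ?_)) hΛ
            · rw [abs_mul, abs_of_pos (by positivity : (0:ℝ) < 10 ^ 10)]
            · rw [abs_mul, abs_of_pos (by positivity : (0:ℝ) < 10 ^ 17)]
            · rw [abs_mul, abs_of_pos (by positivity : (0:ℝ) < 10 ^ 21)]
      _ ≤ 10 * Bd + |Lam (i, j)| * (10 ^ 10 * Bd + 10 ^ 17 * Bd + 10 ^ 21 * Bd) := by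
          gcongr
      _ = (10 + |Lam (i, j)| * (10 ^ 10 + 10 ^ 17 + 10 ^ 21)) * Bd := by ring
  unfold hkForm
  calc |∑ w ∈ WSet 3 3, lam w * blockΛ α (Lam w) (Dθ^[w.1] (Dz^[w.2] F)) (Dθ^[w.1] (Dz^[w.2] g))|
      ≤ ∑ w ∈ WSet 3 3, |lam w * blockΛ α (Lam w) (Dθ^[w.1] (Dz^[w.2] F)) (Dθ^[w.1] (Dz^[w.2] g))| := Finset.abs_sum_le_sum_abs _ _
    _ ≤ ∑ w ∈ WSet 3 3, |lam w| * ((10 + |Lam w| * (10 ^ 10 + 10 ^ 17 + 10 ^ 21)) * Bd) := by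
        refine Finset.sum_le_sum fun w hw => ?_
        rw [abs_mul]
        exact mul_le_mul_of_nonneg_left (hblock w hw) (abs_nonneg _)
    _ = (∑ w ∈ WSet 3 3, |lam w| * (10 + |Lam w| * (10 ^ 10 + 10 ^ 17 + 10 ^ 21))) * Bd := by
        rw [Finset.sum_mul]; refine Finset.sum_congr rfl fun w _ => by ring

section forms

variable {α : ℝ} (hα : 0 < α) (hα10 : α ≤ 10) {u g : ℝ → ℝ → ℝ} (hu : ContDiffOn ℝ ∞ (uncurry u) strip) (hg : StripTest g)
  {B : ℝ} (hB0 : 0 ≤ B)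
include hα hα10 hu hg hB0

omit hα hα10 hB0 in
/-- `u·D_θg` is a test function for `u ∈ C^∞(strip)` and a test function `g`. [folklore] -/
theorem stripTest_mul_Dθ : StripTest (u * Dθ g) := by
  have h := hg.ofDθ.mulOn hu
  have e : (fun z θ => Dθ g z θ * uncurry u (z, θ)) = u * Dθ g := by
    funext z θ; simp only [Pi.mul_apply, uncurry_apply_pair]; ring
  rwa [e] at h

omit hα hα10 hB0 in
/-- `v·D_zg` is a test function for `v ∈ C^∞(strip)` and a test function `g`. [folklore] -/
theorem stripTest_mul_Dz : StripTest (u * Dz g) := by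
  have h := hg.ofDz.mulOn hu
  have e : (fun z θ => Dz g z θ * uncurry u (z, θ)) = u * Dz g := by
    funext z θ; simp only [Pi.mul_apply, uncurry_apply_pair]; ring
  rwa [e] at h

/-- **EGM Proposition 9.5 / Elgindi Lemma 8.9, the `D_θ`-transport with a bounded velocity, at
`k = 4` for test functions**: for every choice of the weights `λ, Λ` of `hkForm α 3 λ Λ`,
`0 < α ≤ 10`, `u ∈ C^∞(strip)` with `|D_θ^iD_z^ju| ≤ B` a.e. on the strip (`i + j ≤ 4`), and a test
function `g`: `|(uD_θg, g)| ≤ C(λ,Λ)·12800·B·|g|²_{𝓗⁴}` — no loss in `γ − 1`. [cite: ElgindiGhoulMasmoudi2021, §9 Proposition 9.5 (p. 20 of arXiv:1910.14071); Elgindi2021, §8.2 Lemma 8.9 (p. 26 of arXiv:1904.04795)] -/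
theorem abs_hkForm_transport_Dθ_sup_le (hB : ∀ᵐ p ∂(volume.restrict strip), ∀ i j : ℕ, i + j ≤ 4 → |(Dθ^[i] (Dz^[j] u)) p.1 p.2| ≤ B)
    (lam Lam : ℕ × ℕ → ℝ) :
    |hkForm α 3 lam Lam (u * Dθ g) g| ≤
      (∑ w ∈ WSet 3 3, |lam w| * (10 + |Lam w| * (10 ^ 10 + 10 ^ 17 + 10 ^ 21))) * (12800 * B * (eHkNormSq α 4 g).toReal) :=
  abs_hkForm_le_of_wordPairing hα (stripTest_mul_Dθ hu hg) hg
    (fun _ _ ha _ hc hgood => abs_wordPairing_Dθ_sup_le hα hα10 hu hg hB0 hB ha hc hgood) lam Lam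

/-- **EGM Proposition 9.5 / Elgindi Lemma 8.9, the `D_z`-transport with a velocity whose angular
words vanish at the boundary, at `k = 4` for test functions**: for every choice of the weights
`λ, Λ` of `hkForm α 3 λ Λ`, `0 < α ≤ 10`, `v ∈ C^∞(strip)` with, a.e. on the strip, `|D_z^jv| ≤ B` and
`|D_θ^iD_z^jv| ≤ B sin 2θ` (`i ≥ 1`, `i + j ≤ 4`), and a test function `g`:
`|(vD_zg, g)| ≤ C(λ,Λ)·12800·B·|g|²_{𝓗⁴}`. [cite: ElgindiGhoulMasmoudi2021, §9 Proposition 9.5 (p. 20 of arXiv:1910.14071); Elgindi2021, §8.2 Lemma 8.9 (p. 26 of arXiv:1904.04795)] -/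
theorem abs_hkForm_transport_Dz_sup_le (hB : ∀ᵐ p ∂(volume.restrict strip), ∀ i j : ℕ, i + j ≤ 4 →
      |(Dθ^[i] (Dz^[j] u)) p.1 p.2| ≤ (if i = 0 then 1 else Real.sin (2 * p.2)) * B)
    (lam Lam : ℕ × ℕ → ℝ) :
    |hkForm α 3 lam Lam (u * Dz g) g| ≤
      (∑ w ∈ WSet 3 3, |lam w| * (10 + |Lam w| * (10 ^ 10 + 10 ^ 17 + 10 ^ 21))) * (12800 * B * (eHkNormSq α 4 g).toReal) :=
  abs_hkForm_le_of_wordPairing hα (stripTest_mul_Dz hu hg) hg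
    (fun _ _ ha _ hc hgood => abs_wordPairing_Dz_sup_le hα hα10 hu hg hB0 hB ha hc hgood) lam Lam

end forms

end Elgindi

end Literature.Analysis.FluidPDE
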